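import Summits.QuantumFields.BalabanUV.Beta.D1BFx.TadpoleParity
import Summits.QuantumFields.BalabanUV.Beta.D1BFx.GhostStencilRooted
import Summits.QuantumFields.BalabanUV.Beta.D1BFx.GhostLeg
import Summits.QuantumFields.BalabanUV.Beta.AxialDressingRootedBmLegs

/-!
# `BalabanUV.Beta.D1BFx.GhostWardTadpoles` — road «BF-x» for binder row D1, slot (K), junction (J3): **«GHOST WARD AT U = 1», FIRST THIRD —
# THE GHOST LEG HAS NO ONE-POINT FUNCTION AGAINST THE GHOST STENCILS** (`tadpole (Ggh n a) (ghCur κ u) = 0`, `tadpole (Ggh n a) (qAntiAt ρ n κ u) = 0`,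
# `tadpole (Ggh n a) (SghAt ρ n cK cQ κ u) = 0`) — AND NONE AGAINST THE `Πᵀ_bm`-DRESSED CURRENT EITHER (`tadpole (Ggh n a) (Πᵀ_bm[ghCur](κ,u)) = 0`)

The OWNER d1-p2 g19's located reading E-2 ∕ A-1 (journal) of the (J3) junction («Q-GH-W′»): the operator `M(U) = n²·D_U*D_U + a·Q′(U)*Q′(U)`,
whose `U = 1` inverse is the road's ghost leg `GhostLeg.Ggh n a` and whose first `U`-jets are `n²•ghCur ⊕ a•qAnti`, is gauge-COVARIANT, so the first
variation of `log det M` vanishes at `U = 1` and the one-loop ghost Hessian is dressing-invariant (Ward).  This file types the FIRST, S-sized third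
of that brick (B2): the vanishing of the three ghost TADPOLES — a SYMMETRIC spread leg (`trK_Ggh`, `spr_Ggh`) against a localised ANTISYMMETRIC
stencil (`ghCur_antisymm` ∕ `qAntiAt_antisymm` ∕ `SghAt_antisymm`, `biLoc_ghCur` ∕ `biLoc_qAntiAt` ∕ `biLoc_SghAt`) has no one-point function
(`TadpoleParity.tadpole_eq_zero_of_symm`, BY NAME).  Stated for ANY symmetric spread leg first (§2), then at `Ggh n a` (§3).  §4: the same for
the DRESSED current of the road (PART 9's jet, `(x, z) ↦ Πᵀ_bm[(κ′,u′) ↦ ghCur κ′ u′ x z](κ, u)` = `AxialDressingRootedBmLegs.coProjBmAt`, in-block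
root): it is antisymmetric in `(x, z)` (linearity) and localised about `u` (window support + `abs_coProjBmAt_le`), so its tadpole against any
symmetric spread leg vanishes too — the «first variation» half of the Ward reading is DRESSING-INVARIANT term by term, whatever the (J3) ruling.

HONEST DEPENDENCY (cell records, verbatim): «continuum YM on T⁴ ⇐ BetaPertH ∧ nine spine estimates (0/9 proved); BetaPertH ⇐ (D1) ∧ (D4) ∧
CAP+tail; G-an2-4 gates asym, D1 and NE2/3/4.»  HONEST FRAMING (cell contract, verbatim): «discharging `BetaPertH` makes Bałaban's UV stability
UNCONDITIONAL — a real constructive-QFT result; it is NOT the continuum limit and NOT the Clay problem.»  THIS MODULE DISCHARGES NOTHING of the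
wall: [folklore] composition BY NAME (`trK`∕`Loc` read-outs of three [our object] stencils + one parity lemma); NOT the transversality third of
(B2) (`hessKer (Ggh) (Πᵀ_bm-dressed full jets) = hessKer (Ggh) (full jets)` — needs the `Q′(U)` jets in the road's tower and the row owner's (Q1)
ruling); decides NOTHING about (J3); no estimate.  No definition, no `def … : Prop`, no notation, nothing cited, 0 sorry.  0 root-level binders of
row D1 discharged (hW ∕ hR-sockets ∕ hSX-socket ∕ D1Tel ∕ D1Rep — 0); (J3) remains DISPLAYED; (K) NOT closed; NOT D1, NOT `BetaPertH`, NOT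
continuum, NOT Clay.

ABSOLUTE RULE (cell charter, verbatim): «No internally-minted statement may enter as a cited fact. Every hypothesis is either kernel-proved in
this package or a verbatim quotation of a PUBLISHED theorem with page reference. The manuscript(s) under audit are NOT citable for their own
disputed steps — they are the thing under adjudication; programme-internal (2001/route/tribunal) claims are never citable.»

Unit `b2b-balaban-beta-d1-formalise-leaf-04` (gen 21), D1 formalisation swarm leaf prover 04, road «BF-x»; (B2) first third, OWNER E-2 (journal).
-/

noncomputable section

open Literature.MathematicalPhysics.QuantumFieldTheory
open Literature.MathematicalPhysics.QuantumFieldTheory.Balaban1983to89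
open Literature.MathematicalPhysics.QuantumFieldTheory.Balaban1983to89.Beta
open ExpKernelCalculus (Site MKer BiLoc tadpole)
open Summit.QuantumFields.BalabanUV.Beta.TameKernelCalculus (Spr Loc trK)
open Summit.QuantumFields.BalabanUV.Beta.D1BFx.TadpoleParity (tadpole_eq_zero_of_symm)
open Summit.QuantumFields.BalabanUV.Beta.D1BFx.GhostLeg (Ggh spr_Ggh trK_Ggh)
open Summit.QuantumFields.BalabanUV.Beta.D1BFx.GhostStencil (ghCur ghCur_antisymm biLoc_ghCur)
open Summit.QuantumFields.BalabanUV.Beta.D1BFx.GhostStencilRooted (qAntiAt SghAt qAntiAt_antisymm SghAt_antisymm biLoc_qAntiAt biLoc_SghAt)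

namespace Summit.QuantumFields.BalabanUV.Beta.D1BFx.GhostWardTadpoles

/-! ## §1 The three ghost stencils are plain-antisymmetric and localised -/

section Stencils

variable (ρ : Site 4) (n : ℕ) (κ : Fin 4) (u : Site 4)

/-- [folklore] `(ghCur κ u)ᵀ = −ghCur κ u` (`ghCur_antisymm`, as a kernel identity). -/
theorem trK_ghCur : trK (ghCur κ u) = -ghCur κ u := by
  funext x z a b
  exact ghCur_antisymm κ u x z a b

/-- [folklore] `ghCur κ u` is localised (`biLoc_ghCur` at rate `1` about `u`). -/
theorem loc_ghCur : Loc (ghCur κ u) :=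
  ⟨u, u, Real.exp 1, 1, one_pos, biLoc_ghCur κ u 1⟩

/-- [folklore] `(qAntiAt ρ n κ u)ᵀ = −qAntiAt ρ n κ u` (`qAntiAt_antisymm`). -/
theorem trK_qAntiAt : trK (qAntiAt ρ n κ u) = -qAntiAt ρ n κ u := by
  funext x z a b
  exact qAntiAt_antisymm ρ n κ u x z a b

/-- [folklore] `(SghAt ρ n cK cQ κ u)ᵀ = −SghAt ρ n cK cQ κ u` (`SghAt_antisymm`). -/
theorem trK_SghAt (cK cQ : ℝ) : trK (SghAt ρ n cK cQ κ u) = -SghAt ρ n cK cQ κ u := by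
  funext x z a b
  exact SghAt_antisymm ρ n κ u cK cQ x z a b

variable [NeZero n] {ρ}

/-- [folklore] `qAntiAt ρ n κ u` is localised (in-block root; `biLoc_qAntiAt` at `δ = 1`, rate `1∕n`). -/
theorem loc_qAntiAt (hρ : ∀ i : Fin 4, 0 ≤ ρ i ∧ ρ i < n) : Loc (qAntiAt ρ n κ u) :=
  ⟨u, u, 8 / (n : ℝ) ^ 3 * Real.exp (8 * 1), 1 / n,
    div_pos one_pos (Nat.cast_pos.mpr (Nat.pos_of_ne_zero (NeZero.ne n))), biLoc_qAntiAt n κ u hρ zero_le_one⟩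

/-- [folklore] `SghAt ρ n cK cQ κ u` is localised (in-block root; `biLoc_SghAt` at `δ = 1`). -/
theorem loc_SghAt (hρ : ∀ i : Fin 4, 0 ≤ ρ i ∧ ρ i < n) (cK cQ : ℝ) : Loc (SghAt ρ n cK cQ κ u) :=
  ⟨u, u, |cK| * Real.exp (1 / n) + |cQ| * (8 / (n : ℝ) ^ 3 * Real.exp (8 * 1)), 1 / n,
    div_pos one_pos (Nat.cast_pos.mpr (Nat.pos_of_ne_zero (NeZero.ne n))), biLoc_SghAt n κ u hρ cK cQ zero_le_one⟩

end Stencils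

/-! ## §2 Any symmetric spread leg: no one-point function against the ghost stencils -/

section Generic

variable {K : MKer 4 Unit} (hK : Spr K) (hKt : trK K = K)
include hK hKt

/-- [folklore] **NO GHOST-KINETIC TADPOLE**: `tadpole K (ghCur κ u) = 0` for a symmetric spread leg `K`. -/
theorem tadpole_ghCur_eq_zero (κ : Fin 4) (u : Site 4) : tadpole K (ghCur κ u) = 0 :=
  tadpole_eq_zero_of_symm hK hKt (loc_ghCur κ u) (trK_ghCur κ u)

/-- [folklore] **NO AVERAGING-JET TADPOLE**: `tadpole K (qAntiAt ρ n κ u) = 0` for a symmetric spread leg `K` (in-block root). -/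
theorem tadpole_qAntiAt_eq_zero {n : ℕ} [NeZero n] {ρ : Site 4} (hρ : ∀ i : Fin 4, 0 ≤ ρ i ∧ ρ i < n) (κ : Fin 4) (u : Site 4) :
    tadpole K (qAntiAt ρ n κ u) = 0 :=
  tadpole_eq_zero_of_symm hK hKt (loc_qAntiAt n κ u hρ) (trK_qAntiAt ρ n κ u)

/-- [folklore] **NO TADPOLE ON THE WHOLE GHOST RAY**: `tadpole K (SghAt ρ n cK cQ κ u) = 0` for every `(cK, cQ)` (in-block root). -/
theorem tadpole_SghAt_eq_zero {n : ℕ} [NeZero n] {ρ : Site 4} (hρ : ∀ i : Fin 4, 0 ≤ ρ i ∧ ρ i < n) (cK cQ : ℝ) (κ : Fin 4) (u : Site 4) :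
    tadpole K (SghAt ρ n cK cQ κ u) = 0 :=
  tadpole_eq_zero_of_symm hK hKt (loc_SghAt n κ u hρ cK cQ) (trK_SghAt ρ n κ u cK cQ)

end Generic

/-! ## §3 At the road's ghost leg `Ggh n a` -/

section GhostLeg

variable (n : ℕ) [NeZero n] {a : ℝ} (ha : 0 < a)
include ha

/-- [folklore] **`tadpole (Ggh n a) (ghCur κ u) = 0`** — the first variation of the ghost-kinetic word vanishes at `U = 1`. -/
theorem tadpole_Ggh_ghCur (κ : Fin 4) (u : Site 4) : tadpole (Ggh n a) (ghCur κ u) = 0 :=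
  tadpole_ghCur_eq_zero (spr_Ggh n a ha) (trK_Ggh n a ha) κ u

/-- [folklore] **`tadpole (Ggh n a) (qAntiAt ρ n κ u) = 0`** — the first variation of the `a·Q′*Q′` word vanishes at `U = 1` (in-block root). -/
theorem tadpole_Ggh_qAntiAt {ρ : Site 4} (hρ : ∀ i : Fin 4, 0 ≤ ρ i ∧ ρ i < n) (κ : Fin 4) (u : Site 4) :
    tadpole (Ggh n a) (qAntiAt ρ n κ u) = 0 :=
  tadpole_qAntiAt_eq_zero (spr_Ggh n a ha) (trK_Ggh n a ha) hρ κ u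

/-- [folklore] **`tadpole (Ggh n a) (SghAt ρ n cK cQ κ u) = 0`** for every ray `(cK, cQ)` (in-block root) — in particular on the END's ray of record
and on the dressed same-block bond shape `SghAt ρ n 1 n⁴` (OWNER INTENT-6 «GH-DRESS FORMULA»). -/
theorem tadpole_Ggh_SghAt {ρ : Site 4} (hρ : ∀ i : Fin 4, 0 ≤ ρ i ∧ ρ i < n) (cK cQ : ℝ) (κ : Fin 4) (u : Site 4) :
    tadpole (Ggh n a) (SghAt ρ n cK cQ κ u) = 0 :=
  tadpole_SghAt_eq_zero (spr_Ggh n a ha) (trK_Ggh n a ha) hρ cK cQ κ u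

end GhostLeg

/-! ## §4 The `Πᵀ_bm`-DRESSED ghost current (PART 9's jet) has no one-point function either -/

section Dressed

open Finset
open scoped BigOperators
open B12Sec2to5 (l1 l1_nonneg)
open ExpKernelCalculus (l1_sub_triangle)
open AffineAveraging (box toSite unitVec)
open Summit.QuantumFields.BalabanUV.Beta.AxialDressingRooted (coProjBmAt coProjBmAt_apply cube l1_le_of_mem_cube abs_coProjBmAt_le cWb cWb_nonneg)
open Summit.QuantumFields.BalabanUV.Beta.D1BFx.GhostStencil (ghCur_apply l1_unitVec)

/-- [folklore] **THE DRESSED CURRENT IS ANTISYMMETRIC IN THE KERNEL ENTRY** (any root, any window): `Πᵀ_bm[ghCur · · z x](κ,u) = −Πᵀ_bm[ghCur · · x z](κ,u)`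
(`coProjBmAt` is linear in the form, `ghCur_antisymm`). -/
theorem trK_coProj_ghCur (ρ : Site 4) (N : ℕ) (κ : Fin 4) (u : Site 4) :
    trK (fun x z a b => coProjBmAt ρ N (fun κ' u' => ghCur κ' u' x z a b) κ u)
      = -(fun x z a b => coProjBmAt ρ N (fun κ' u' => ghCur κ' u' x z a b) κ u) := by
  funext x z a b
  show coProjBmAt ρ N (fun κ' u' => ghCur κ' u' z x b a) κ u = -coProjBmAt ρ N (fun κ' u' => ghCur κ' u' x z a b) κ u
  rw [coProjBmAt_apply, coProjBmAt_apply, ← Finset.sum_neg_distrib]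
  refine Finset.sum_congr rfl fun v _ => ?_
  rw [← Finset.sum_neg_distrib]
  refine Finset.sum_congr rfl fun β _ => ?_
  rw [ghCur_antisymm, mul_neg]

variable {N : ℕ} (hN : 1 ≤ N) {r : Fin 4 → ℕ} (hr : r ∈ box 4 N) (κ : Fin 4) (u : Site 4)
include hN hr

/-- [folklore] **THE DRESSED CURRENT IS LOCALISED ABOUT ITS BOND** (in-block root): a non-zero entry `(x, z)` is a bond `(u+v, u+v+e_β)` of the
window (`v ∈ cube`, `|v|₁ ≤ 4N`), so `BiLoc (Πᵀ_bm[ghCur](κ,u)) u u (cWb 3 N·e^{2δ(4N+1)}) δ` for every `δ ≥ 0` (sup by `abs_coProjBmAt_le` at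
`|ghCur| ≤ 1`). -/
theorem biLoc_coProj_ghCur {δ : ℝ} (hδ : 0 ≤ δ) :
    BiLoc (fun x z a b => coProjBmAt (toSite r) N (fun κ' u' => ghCur κ' u' x z a b) κ u) u u
      (cWb 3 N * Real.exp (δ * (2 * (4 * N + 1)))) δ := by
  intro x z a b
  by_cases h0 : coProjBmAt (toSite r) N (fun κ' u' => ghCur κ' u' x z a b) κ u = 0
  · show |coProjBmAt (toSite r) N (fun κ' u' => ghCur κ' u' x z a b) κ u| ≤ _
    rw [h0, abs_zero]
    exact mul_nonneg (mul_nonneg (cWb_nonneg 3 N) (Real.exp_pos _).le) (Real.exp_pos _).le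
  · -- support: some window term is non-zero, hence `(x, z)` is a bond at `u + v`
    have h0' := h0
    rw [coProjBmAt_apply] at h0'
    obtain ⟨v, hv, hv0⟩ := Finset.exists_ne_zero_of_sum_ne_zero h0'
    obtain ⟨β, -, hβ0⟩ := Finset.exists_ne_zero_of_sum_ne_zero hv0
    have hg : ghCur β (u + v) x z a b ≠ 0 := fun h => hβ0 (by rw [h, mul_zero])
    have hxz : (x = u + v + unitVec β ∧ z = u + v) ∨ (x = u + v ∧ z = u + v + unitVec β) := by
      by_contra hc
      apply hg
      rw [ghCur_apply, if_neg (fun h => hc (Or.inl h)), if_neg (fun h => hc (Or.inr h)), sub_zero]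
    have hv1 : l1 v ≤ 4 * (N : ℝ) := by
      have h := l1_le_of_mem_cube hv
      norm_num at h
      exact h
    have he : l1 (v + unitVec β) ≤ l1 v + 1 := by
      have h := l1_sub_triangle (v + unitVec β) v 0
      rw [sub_zero, sub_zero, add_sub_cancel_left, l1_unitVec] at h
      linarith
    have hdist : l1 (x - u) + l1 (z - u) ≤ 2 * (4 * (N : ℝ) + 1) := by
      rcases hxz with ⟨hx, hz⟩ | ⟨hx, hz⟩
      · rw [hx, hz, show u + v + unitVec β - u = v + unitVec β by abel, show u + v - u = v by abel]
        linarith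
      · rw [hx, hz, show u + v + unitVec β - u = v + unitVec β by abel, show u + v - u = v by abel]
        linarith
    have hab : |coProjBmAt (toSite r) N (fun κ' u' => ghCur κ' u' x z a b) κ u| ≤ cWb 3 N * 1 :=
      abs_coProjBmAt_le hN hr _ κ u (fun κ' v' _ => by
        have h := biLoc_ghCur κ' (u + v') 0 x z a b
        rw [Real.exp_zero, one_mul, neg_zero, zero_mul, Real.exp_zero] at h
        exact h)
    show |coProjBmAt (toSite r) N (fun κ' u' => ghCur κ' u' x z a b) κ u| ≤ _
    calc |coProjBmAt (toSite r) N (fun κ' u' => ghCur κ' u' x z a b) κ u| ≤ cWb 3 N * 1 := hab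
      _ = cWb 3 N * Real.exp (δ * (2 * (4 * N + 1))) * Real.exp (-(δ * (2 * (4 * N + 1)))) := by
          rw [mul_assoc, ← Real.exp_add, add_neg_cancel, Real.exp_zero]
      _ ≤ cWb 3 N * Real.exp (δ * (2 * (4 * N + 1))) * Real.exp (-δ * (l1 (x - u) + l1 (z - u))) := by
          refine mul_le_mul_of_nonneg_left ?_ (mul_nonneg (cWb_nonneg 3 N) (Real.exp_pos _).le)
          rw [Real.exp_le_exp]
          nlinarith [hdist, hδ, l1_nonneg (x - u), l1_nonneg (z - u)]

/-- [folklore] Hence the dressed current is localised (`Loc`, rate 1). -/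
theorem loc_coProj_ghCur : Loc (fun x z a b => coProjBmAt (toSite r) N (fun κ' u' => ghCur κ' u' x z a b) κ u) :=
  ⟨u, u, cWb 3 N * Real.exp (1 * (2 * (4 * N + 1))), 1, one_pos, biLoc_coProj_ghCur hN hr κ u zero_le_one⟩

/-- [folklore] **NO ONE-POINT FUNCTION FOR THE DRESSED CURRENT** against any symmetric spread leg. -/
theorem tadpole_coProj_ghCur_eq_zero {K : MKer 4 Unit} (hK : Spr K) (hKt : trK K = K) :
    tadpole K (fun x z a b => coProjBmAt (toSite r) N (fun κ' u' => ghCur κ' u' x z a b) κ u) = 0 :=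
  tadpole_eq_zero_of_symm hK hKt (loc_coProj_ghCur hN hr κ u) (trK_coProj_ghCur (toSite r) N κ u)

/-- [folklore] **`tadpole (Ggh N a) (Πᵀ_bm[ghCur](κ,u)) = 0`** — the first variation of the road's DRESSED ghost-kinetic word (PART 9's jet,
up to its scalar `n²`) vanishes at `U = 1` exactly as the undressed one (§3): dressing-invariance of the first variation, term by term. -/
theorem tadpole_Ggh_coProj_ghCur [NeZero N] {a : ℝ} (ha : 0 < a) :
    tadpole (Ggh N a) (fun x z a b => coProjBmAt (toSite r) N (fun κ' u' => ghCur κ' u' x z a b) κ u) = 0 :=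
  tadpole_coProj_ghCur_eq_zero hN hr κ u (spr_Ggh N a ha) (trK_Ggh N a ha)

end Dressed

end Summit.QuantumFields.BalabanUV.Beta.D1BFx.GhostWardTadpoles

end
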